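import Summits.Ventures.PackingBounds.SphericalCodes.DegreeFiveEquality

/-!
# `L₅ − 1` rows: integral Levenshtein degree-5 values with irrational nodes are not attained

Framing: lottery ticket; floor = certified bounds/negative ranges. Venture `PackingBounds`
(cell `pub-packcert`), spherical-code family, standard-angle grid of the cell (`s = 1/3, 1/4`, `n ≥ 15`).

In each cell below the exact Delsarte value is Levenshtein's `L₅(n, s) = N`, an integer, realised by
`f(t) = (t - s)(t² + p t + q)²` with rational `p, q` (conjugate irrational double roots; the cell's LP
certificates `certs/codes/code_n<n>_s<p>-<q>.json` round the roots and read `N + 1e-10`, the exact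
value is `N`: `pub-packcert-lp/results/lp-equality-l5-irrational.json`, two engines). The Gegenbauer
coefficients below are exact rationals, re-derived here by `simp; ring`. A code of size `N` would force
`m (s² + ps + q) = N/n - 1 - p + q(N - 1)` for the natural number `m = #{y : ⟨x,y⟩ = s}`
(`degree_five_card_le_of_no_valency`); the right-hand side divided by `s² + ps + q` is not a natural
number in these cells, so `A(n, s) ≤ N - 1`. No three-point (SDP) value exists in the cell for these
`n` (double-precision wall `n ≥ 11`). Prior art for the phenomenon: Levenshtein 1992, Boyvalenkov–Landgev
1995 — classical consequences; certified kernel rows of the `pub-packcert` grid. The cell `(13, 1/3)`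
(`L₅ = 338`, `m = 117` natural) needs the Galois step and is not treated here.

## References
* V. I. Levenshtein, Acta Appl. Math. 29 (1992) 1–82.
* P. Delsarte, J. M. Goethals, J. J. Seidel, Geom. Dedicata 6 (1977) 363–388, §4. [`DelsarteGoethalsSeidel1977`]
-/

namespace Summit.Ventures.PackingBounds.SphericalCodes

open Finset Literature.Analysis.SpecialFunctions Literature.Geometry.DiscreteGeometry

/-- **`A(15, arccos 1/3) ≤ 575`**: every finite set of unit vectors of `ℝ^15` with pairwise inner
products `≤ 1 / 3` has at most `575` elements. Levenshtein's `L₅(15, 1 / 3) = 576` (certificate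
`(t - 1 / 3)(t² + (4 / 7)·t + 5 / 119)²`, irrational nodes) is not attained: the forced `s`-valency would be
`m = 20412 / 115 ∉ ℕ`. (LP equality case, Galois-free route; certified `L₅ − 1` row of the `pub-packcert` grid.) -/
theorem code_dim15_third_le_575 (C : Finset (EuclideanSpace ℝ (Fin 15)))
    (h1 : ∀ x ∈ C, ‖x‖ = 1) (h2 : ∀ x ∈ C, ∀ y ∈ C, x ≠ y → inner ℝ x y ≤ 1 / 3) :
    C.card ≤ 575 := by
  have h := degree_five_card_le_of_no_valency (n := 15) (μ := 13 / 2) (by norm_num) (by norm_num)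
    (1 / 3) (4 / 7) (5 / 119)
    (fun k => match k with
      | 0 => 128 / 42483
      | 1 => 30208 / 10493301
      | 2 => 352 / 205751
      | 3 => 2528 / 2761395
      | 4 => 8 / 25935
      | 5 => 8 / 88179
      | _ => 0)
    (by intro k; split <;> norm_num) (by norm_num) (by norm_num) (by norm_num)
    (by
      intro t
      simp [Finset.sum_range_succ, gegenbauerSum, gegenbauerCoeff, Finset.prod_range_succ,
        Nat.factorial]
      ring)
    576 (by norm_num) (by norm_num)
    (by
      intro m hm
      norm_num at hm
      have h' : (1840 : ℝ) * m = 326592 := by linarith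
      have h'' : (1840 : ℤ) * m = 326592 := by exact_mod_cast h'
      omega)
    C h1 h2
  omega

/-- **`A(16, arccos 1/4) ≤ 311`**: every finite set of unit vectors of `ℝ^16` with pairwise inner
products `≤ 1 / 4` has at most `311` elements. Levenshtein's `L₅(16, 1 / 4) = 312` (certificate
`(t - 1 / 4)(t² + (1)·t + 1 / 6)²`, irrational nodes) is not attained: the forced `s`-valency would be
`m = 3328 / 23 ∉ ℕ`. (LP equality case, Galois-free route; certified `L₅ − 1` row of the `pub-packcert` grid.) -/
theorem code_dim16_quarter_le_311 (C : Finset (EuclideanSpace ℝ (Fin 16)))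
    (h1 : ∀ x ∈ C, ‖x‖ = 1) (h2 : ∀ x ∈ C, ∀ y ∈ C, x ≠ y → inner ℝ x y ≤ 1 / 4) :
    C.card ≤ 311 := by
  have h := degree_five_card_le_of_no_valency (n := 16) (μ := 7) (by norm_num) (by norm_num)
    (1 / 4) (1) (1 / 6)
    (fun k => match k with
      | 0 => 13 / 1152
      | 1 => 1 / 112
      | 2 => 3 / 640
      | 3 => 85 / 44352
      | 4 => 1 / 1920
      | 5 => 1 / 14784
      | _ => 0)
    (by intro k; split <;> norm_num) (by norm_num) (by norm_num) (by norm_num)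
    (by
      intro t
      simp [Finset.sum_range_succ, gegenbauerSum, gegenbauerCoeff, Finset.prod_range_succ,
        Nat.factorial]
      ring)
    312 (by norm_num) (by norm_num)
    (by
      intro m hm
      norm_num at hm
      have h' : (23 : ℝ) * m = 3328 := by linarith
      have h'' : (23 : ℤ) * m = 3328 := by exact_mod_cast h'
      omega)
    C h1 h2
  omega

/-- **`A(16, arccos 1/3) ≤ 751`**: every finite set of unit vectors of `ℝ^16` with pairwise inner
products `≤ 1 / 3` has at most `751` elements. Levenshtein's `L₅(16, 1 / 3) = 752` (certificate
`(t - 1 / 3)(t² + (8 / 15)·t + 1 / 30)²`, irrational nodes) is not attained: the forced `s`-valency would be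
`m = 6345 / 29 ∉ ℕ`. (LP equality case, Galois-free route; certified `L₅ − 1` row of the `pub-packcert` grid.) -/
theorem code_dim16_third_le_751 (C : Finset (EuclideanSpace ℝ (Fin 16)))
    (h1 : ∀ x ∈ C, ‖x‖ = 1) (h2 : ∀ x ∈ C, ∀ y ∈ C, x ≠ y → inner ℝ x y ≤ 1 / 3) :
    C.card ≤ 751 := by
  have h := degree_five_card_le_of_no_valency (n := 16) (μ := 7) (by norm_num) (by norm_num)
    (1 / 3) (8 / 15) (1 / 30)
    (fun k => match k with
      | 0 => 47 / 21600
      | 1 => 163 / 75600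
      | 2 => 187 / 151200
      | 3 => 557 / 831600
      | 4 => 11 / 50400
      | 5 => 1 / 14784
      | _ => 0)
    (by intro k; split <;> norm_num) (by norm_num) (by norm_num) (by norm_num)
    (by
      intro t
      simp [Finset.sum_range_succ, gegenbauerSum, gegenbauerCoeff, Finset.prod_range_succ,
        Nat.factorial]
      ring)
    752 (by norm_num) (by norm_num)
    (by
      intro m hm
      norm_num at hm
      have h' : (29 : ℝ) * m = 6345 := by linarith
      have h'' : (29 : ℤ) * m = 6345 := by exact_mod_cast h'
      omega)
    C h1 h2
  omega

/-- **`A(17, arccos 1/3) ≤ 985`**: every finite set of unit vectors of `ℝ^17` with pairwise inner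
products `≤ 1 / 3` has at most `985` elements. Levenshtein's `L₅(17, 1 / 3) = 986` (certificate
`(t - 1 / 3)(t² + (1 / 2)·t + 1 / 38)²`, irrational nodes) is not attained: the forced `s`-valency would be
`m = 7047 / 26 ∉ ℕ`. (LP equality case, Galois-free route; certified `L₅ − 1` row of the `pub-packcert` grid.) -/
theorem code_dim17_third_le_985 (C : Finset (EuclideanSpace ℝ (Fin 17)))
    (h1 : ∀ x ∈ C, ‖x‖ = 1) (h2 : ∀ x ∈ C, ∀ y ∈ C, x ≠ y → inner ℝ x y ≤ 1 / 3) :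
    C.card ≤ 985 := by
  have h := degree_five_card_le_of_no_valency (n := 17) (μ := 15 / 2) (by norm_num) (by norm_num)
    (1 / 3) (1 / 2) (1 / 38)
    (fun k => match k with
      | 0 => 29 / 18411
      | 1 => 187 / 113715
      | 2 => 37 / 40698
      | 3 => 2119 / 4234530
      | 4 => 16 / 101745
      | 5 => 8 / 156009
      | _ => 0)
    (by intro k; split <;> norm_num) (by norm_num) (by norm_num) (by norm_num)
    (by
      intro t
      simp [Finset.sum_range_succ, gegenbauerSum, gegenbauerCoeff, Finset.prod_range_succ,
        Nat.factorial]
      ring)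
    986 (by norm_num) (by norm_num)
    (by
      intro m hm
      norm_num at hm
      have h' : (52 : ℝ) * m = 14094 := by linarith
      have h'' : (52 : ℤ) * m = 14094 := by exact_mod_cast h'
      omega)
    C h1 h2
  omega

/-- **`A(21, arccos 1/4) ≤ 755`**: every finite set of unit vectors of `ℝ^21` with pairwise inner
products `≤ 1 / 4` has at most `755` elements. Levenshtein's `L₅(21, 1 / 4) = 756` (certificate
`(t - 1 / 4)(t² + (2 / 3)·t + 5 / 69)²`, irrational nodes) is not attained: the forced `s`-valency would be
`m = 32768 / 111 ∉ ℕ`. (LP equality case, Galois-free route; certified `L₅ − 1` row of the `pub-packcert` grid.) -/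
theorem code_dim21_quarter_le_755 (C : Finset (EuclideanSpace ℝ (Fin 21)))
    (h1 : ∀ x ∈ C, ‖x‖ = 1) (h2 : ∀ x ∈ C, ∀ y ∈ C, x ≠ y → inner ℝ x y ≤ 1 / 4) :
    C.card ≤ 755 := by
  have h := degree_five_card_le_of_no_valency (n := 21) (μ := 19 / 2) (by norm_num) (by norm_num)
    (1 / 4) (2 / 3) (5 / 69)
    (fun k => match k with
      | 0 => 100 / 33327
      | 1 => 14 / 6555
      | 2 => 38 / 36225
      | 3 => 778 / 1899639
      | 4 => 26 / 229425
      | 5 => 8 / 412965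
      | _ => 0)
    (by intro k; split <;> norm_num) (by norm_num) (by norm_num) (by norm_num)
    (by
      intro t
      simp [Finset.sum_range_succ, gegenbauerSum, gegenbauerCoeff, Finset.prod_range_succ,
        Nat.factorial]
      ring)
    756 (by norm_num) (by norm_num)
    (by
      intro m hm
      norm_num at hm
      have h' : (111 : ℝ) * m = 32768 := by linarith
      have h'' : (111 : ℤ) * m = 32768 := by exact_mod_cast h'
      omega)
    C h1 h2
  omega

/-- **`A(23, arccos 1/4) ≤ 1046`**: every finite set of unit vectors of `ℝ^23` with pairwise inner
products `≤ 1 / 4` has at most `1046` elements. Levenshtein's `L₅(23, 1 / 4) = 1047` (certificate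
`(t - 1 / 4)(t² + (10 / 17)·t + 23 / 425)²`, irrational nodes) is not attained: the forced `s`-valency would be
`m = 1429504 / 3749 ∉ ℕ`. (LP equality case, Galois-free route; certified `L₅ − 1` row of the `pub-packcert` grid.) -/
theorem code_dim23_quarter_le_1046 (C : Finset (EuclideanSpace ℝ (Fin 23)))
    (h1 : ∀ x ∈ C, ‖x‖ = 1) (h2 : ∀ x ∈ C, ∀ y ∈ C, x ≠ y → inner ℝ x y ≤ 1 / 4) :
    C.card ≤ 1046 := by
  have h := degree_five_card_le_of_no_valency (n := 23) (μ := 21 / 2) (by norm_num) (by norm_num)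
    (1 / 4) (10 / 17) (23 / 425)
    (fun k => match k with
      | 0 => 349 / 180625
      | 1 => 74 / 54621
      | 2 => 14 / 21675
      | 3 => 211606 / 843338125
      | 4 => 2 / 29325
      | 5 => 8 / 630315
      | _ => 0)
    (by intro k; split <;> norm_num) (by norm_num) (by norm_num) (by norm_num)
    (by
      intro t
      simp [Finset.sum_range_succ, gegenbauerSum, gegenbauerCoeff, Finset.prod_range_succ,
        Nat.factorial]
      ring)
    1047 (by norm_num) (by norm_num)
    (by
      intro m hm
      norm_num at hm
      have h' : (41239 : ℝ) * m = 15724544 := by linarith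
      have h'' : (41239 : ℤ) * m = 15724544 := by exact_mod_cast h'
      omega)
    C h1 h2
  omega

end Summit.Ventures.PackingBounds.SphericalCodes
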